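import Literature.MathematicalPhysics.QuantumFieldTheory.OSLocalTube
import Literature.MathematicalPhysics.QuantumFieldTheory.WightmanProofs
import Literature.MathematicalPhysics.QuantumLattice.WightmanTubeLaplace
import Literature.MathematicalPhysics.QuantumLattice.WightmanLocality
import Literature.MathematicalPhysics.QuantumLattice.SchwartzTranslationCutoff
import Mathlib.Geometry.Manifold.PartitionOfUnity
import Mathlib.Analysis.InnerProductSpace.Projection.Reflection
import HarnessLib

/-!
# Locality (R3) of the Osterwalder–Schrader boundary values: `OS1973_local` from the continuation
theorem, the Fourier–Laplace growth estimate and the Bargmann–Hall–Wightman theorem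

Topic `Literature/MathematicalPhysics/QuantumFieldTheory`; final file of the decomposition of
the named fact `Literature.MathematicalPhysics.QuantumFieldTheory.OS1973_local` — conjunct (A₃,
R3) of `os_reconstruction` (`WightmanProofs`), Osterwalder–Schrader I (1973), §4.5 "Locality"
(p. 97): from the symmetry (E3) of the Schwinger functions, the analytic continuation (4.12), its
Lorentz invariance (4.14), the Bargmann–Hall–Wightman theorem and "a theorem in [Jost], p. 83" the
boundary distributions `𝔚ₙ(x₁, …, xₙ)` satisfy (R3). Here **`OS1973_local` is proved** from three
classical named facts, none specific to OS:

* `OS1975_exists_continuation_halfSpace` (A₁₂⁺, the analytic core of OS II with the half-space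
  support of the Fourier–Laplace representation; already in the trust base of
  `os_reconstruction_of_remaining'`);
* `Literature.Analysis.Distribution.fourierLaplace_coneSupport_edgeGrowth` (the Fourier–Laplace
  representation of a tempered distribution with spectrum in a cone, with the growth estimate at
  the edge of the tube; Streater–Wightman Thm. 2-10 (2-80), Vladimirov §26.4);
* `exists_extension_extendedForwardTube` (the Bargmann–Hall–Wightman theorem, Streater–Wightman
  Thm. 2-11).

The route (module docstrings of `OSPermutedBoost`, `OSLocalTube`): the OS continuation family `𝒲`
of `S` is unique, so it is the family of (A₁₂⁺); its Fourier transform is supported in the spectral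
set (half-space support upgraded by the proved Lorentz invariance, `OS1973_spectralCondition_of_
halfSpace`), whence by the Fourier–Laplace fact each `𝒲ₙ` is the boundary value of a function
holomorphic on `𝒯ₙ` with polynomial growth at the edge, which coincides with the OS continuation
`𝔚ₙ` (uniqueness of boundary values) — so `𝔚ₙ` has edge growth
(`hasEdgeGrowth_of_fourierSupportedIn`). The local theorem `apply_permTest_swap_eq_of_edgeGrowth`
(`OSLocalTube`: imaginary boost, functional equation from (E3)+(E1), BHW, Hörmander 3.1.15) gives
`𝒲ₙ(F) = 𝒲ₙ(F ∘ (j j+1))` for `F` compactly supported near any configuration whose difference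
`x_{j+1} − x_j` is space-like and points in the first spatial direction; a spatial reflection
(E1 again, `HasDistributionalBoundaryValue.lorentz_eq`) removes the direction condition
(`exists_nhds_apply_permTest_swap_eq`); a smooth partition of unity gives the distributional form
of locality for compactly supported test functions (`isLocalDistribution_of_locally`, the tree's
`IsLocalDistribution`, Streater–Wightman (3-34)); cutting off and the continuity of `𝒲ₙ` give it
for all test functions supported in the space-like region, in particular for the products of
one-point test functions with space-like separated supports (`isLocalFamily_of_isLocalDistribution`).
Assembly: `OS1973_local_of_facts` and `os_reconstruction_of_facts`.

Scope: every `d ≥ 1` (the statement of `OS1973_local`); the argument is dimension-free (no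
connectedness of intersections of permuted extended tubes is used, only points of `𝒯'ₙ` one complex
boost away from `𝒯ₙ`).

## References

* K. Osterwalder, R. Schrader, *Axioms for Euclidean Green's functions*, Comm. Math. Phys. 31
  (1973) 83–112, §4.5 p. 97. [OsterwalderSchraderCMP1973]
* K. Osterwalder, R. Schrader, *Axioms for Euclidean Green's functions II*, Comm. Math. Phys. 42
  (1975) 281–305, §IV.1 Theorem E'→R'. [OsterwalderSchraderCMP1975]
* R. F. Streater, A. S. Wightman, *PCT, Spin and Statistics, and All That* (1964), §3-3
  (3-27), (3-34); Thms. 2-10, 2-11. [StreaterWightman1964]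
-/

noncomputable section

open MeasureTheory Filter Complex Set Metric
open _root_.Topology
open scoped SchwartzMap Manifold ContDiff
open Literature.MathematicalPhysics.QuantumLattice Literature.MathematicalPhysics.QuantumFieldTheory
open Literature.Analysis.Distribution Literature.Analysis.FunctionSpaces

namespace Literature.MathematicalPhysics.QuantumFieldTheory

variable {d n : ℕ}

/-! ### Edge growth of a continuation from the Fourier–Laplace representation -/

/-- **Polynomial growth at the edge from the Fourier–Laplace representation.** If `𝔚` is
holomorphic on `𝒯ₙ` with distributional boundary value `T` whose Fourier transform is supported
in the spectral set, then, granted the Fourier–Laplace fact with edge growth on `ℝ^{n(1+d)}`, `𝔚`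
has polynomial growth at the edge of the tube (`HasEdgeGrowth`): the Fourier–Laplace transform of
`T̃` is holomorphic on the relative tube with the edge estimate and has boundary value `T`, hence
equals `𝔚` on `𝒯ₙ` (uniqueness of boundary values, Streater–Wightman Thm. 2-17).
[cite: StreaterWightman1964, Thm 2-10 eq. (2-80)] -/
theorem hasEdgeGrowth_of_fourierSupportedIn {𝔚 : (Fin n → Fin (d + 1) → ℂ) → ℂ}
    {T : 𝓢((Fin n → SpaceTime d), ℂ) →L[ℂ] ℂ} (h𝔚 : DifferentiableOn ℂ 𝔚 (forwardTube d n))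
    (hbv : HasDistributionalBoundaryValue 𝔚 T) (hT : FourierSupportedIn T (spectralSet d n))
    (hL : fourierLaplace_coneSupport_edgeGrowth (Fin n × Fin (d + 1))) : HasEdgeGrowth 𝔚 := by
  -- the flattened distribution and the flattened spectral set
  set unflat : 𝓢(EuclideanSpace ℝ (Fin n × Fin (d + 1)), ℂ) →L[ℂ] 𝓢((Fin n → SpaceTime d), ℂ) :=
    SchwartzMap.compCLMOfContinuousLinearEquiv ℂ (flattenCLE d n) with hunflat
  set T' : 𝓢(EuclideanSpace ℝ (Fin n × Fin (d + 1)), ℂ) →L[ℂ] ℂ := T.comp unflat with hT'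
  have hflat : ∀ φ : 𝓢(EuclideanSpace ℝ (Fin n × Fin (d + 1)), ℂ), flattenTest (unflat φ) = φ := by
    intro φ; ext y; simp [hunflat]
  set S₀ : Set (EuclideanSpace ℝ (Fin n × Fin (d + 1))) := flattenCLE d n '' spectralSet d n with hS₀
  have hSc : IsClosed S₀ := (flattenCLE d n).toHomeomorph.isClosedMap _ isClosed_spectralSet
  have hSconv : Convex ℝ S₀ :=
    (convex_spectralSet (d := d) (n := n)).linear_image (flattenCLE d n).toLinearEquiv.toLinearMap
  have hScone : ∀ c : ℝ, 0 ≤ c → ∀ ξ ∈ S₀, c • ξ ∈ S₀ := by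
    rintro c hc _ ⟨p, hp, rfl⟩
    exact ⟨c • p, smul_mem_spectralSet hp hc, by simp⟩
  have hT'0 : ∀ φ : 𝓢(EuclideanSpace ℝ (Fin n × Fin (d + 1)), ℂ),
      Disjoint (tsupport (⇑(SchwartzMap.fourierTransformCLM ℂ φ))) S₀ → T' φ = 0 := by
    intro φ hφ
    have h := hT (unflat φ)
    rw [hflat] at h
    exact h hφ
  obtain ⟨F₀, hF₀, -, hedge, hbv₀⟩ := hL T' S₀ hSc hSconv hScone hT'0
  -- the flattened Fourier–Laplace function on the tube and its boundary value
  set 𝔚₂ : (Fin n → Fin (d + 1) → ℂ) → ℂ := fun z => F₀ (configUncurry d n z) with h𝔚₂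
  have h𝔚₂d : DifferentiableOn ℂ 𝔚₂ (forwardTube d n) := by
    refine (hF₀.comp (configUncurry d n).differentiable.differentiableOn fun z hz => ?_)
    show (WithLp.toLp 2 fun i => (configUncurry d n z i).im) ∈ interior (polarCone S₀)
    rw [toLp_im_configUncurry]
    exact flattenCLE_mem_interior_polarCone (tubeCone_subset_relTubeCone
      ((mem_forwardTube_iff_imPart_mem_tubeCone z).1 hz))
  have hbv₂ : HasDistributionalBoundaryValue 𝔚₂ T := by
    intro η hη G
    have hy := flattenCLE_mem_interior_polarCone (tubeCone_subset_relTubeCone hη)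
    have hlim := hbv₀ (flattenCLE d n η) hy (flattenTest G)
    have hTG : T' (flattenTest G) = T G := by
      simp only [hT', ContinuousLinearMap.comp_apply]
      congr 1
    rw [hTG] at hlim
    refine hlim.congr fun t => ?_
    rw [← integral_comp_flattenCLE]
    refine integral_congr_ae (Eventually.of_forall fun x => ?_)
    simp only [h𝔚₂, configUncurry_ray, flattenTest_apply, ContinuousLinearEquiv.symm_apply_apply]
  -- `𝔚 = 𝔚₂` on the forward tube
  have heq : EqOn 𝔚 𝔚₂ (forwardTube d n) := by
    intro z hz
    have h := eq_zero_of_distributionalBoundaryValue_zero_holds (fun z => 𝔚 z - 𝔚₂ z)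
      (h𝔚.sub h𝔚₂d) ?_ z hz
    · exact sub_eq_zero.1 h
    intro η hη F hF
    have t₁₂ := (hbv η hη F).sub (hbv₂ η hη F)
    rw [sub_self] at t₁₂
    refine t₁₂.congr' ?_
    filter_upwards [self_mem_nhdsWithin] with t ht
    rw [← integral_sub (integrable_ray_mul h𝔚 hη ht hF) (integrable_ray_mul h𝔚₂d hη ht hF)]
    simp only [sub_mul]
  -- the edge growth
  intro K hKc hKΓ R
  set K' : Set (EuclideanSpace ℝ (Fin n × Fin (d + 1))) := flattenCLE d n '' K with hK'
  have hK'c : IsCompact K' := hKc.image (flattenCLE d n).continuous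
  have hK'sub : K' ⊆ interior (polarCone S₀) := by
    rintro _ ⟨η, hη, rfl⟩
    exact flattenCLE_mem_interior_polarCone (tubeCone_subset_relTubeCone (hKΓ hη))
  obtain ⟨c, N, r, hc⟩ := hedge K' hK'c hK'sub
  set Lf : ℝ := ‖(flattenCLE d n).toContinuousLinearMap‖ with hLf
  refine ⟨|c| * (1 + Lf * |R|) ^ N, r, fun x hx η hη t ht0 ht1 => ?_⟩
  rw [heq (mem_forwardTube_of_mem_tubeCone x η (hKΓ hη) ht0)]
  simp only [h𝔚₂, configUncurry_ray]
  have h := hc (flattenCLE d n x) (flattenCLE d n η) ⟨η, hη, rfl⟩ t ht0 ht1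
  have hfx : ‖flattenCLE d n x‖ ≤ Lf * |R| :=
    calc ‖flattenCLE d n x‖ ≤ Lf * ‖x‖ := (flattenCLE d n).toContinuousLinearMap.le_opNorm x
      _ ≤ Lf * |R| := mul_le_mul_of_nonneg_left (hx.trans (le_abs_self R)) (norm_nonneg _)
  have htr : 0 < t⁻¹ ^ r := pow_pos (inv_pos.2 ht0) r
  calc _ ≤ c * (1 + ‖flattenCLE d n x‖) ^ N * t⁻¹ ^ r := h
    _ ≤ |c| * (1 + ‖flattenCLE d n x‖) ^ N * t⁻¹ ^ r := by
        gcongr; exact le_abs_self c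
    _ ≤ |c| * (1 + Lf * |R|) ^ N * t⁻¹ ^ r := by gcongr

/-! ### The local statement for an arbitrary space-like pair (spatial reflection) -/

/-- A space-like vector has `|ξ⁰| < ‖ξ⃗‖`. [folklore] -/
theorem abs_apply_zero_lt_norm_spaceC_of_isSpacelike {ξ : SpaceTime d} (hξ : IsSpacelike ξ) :
    |ξ 0| < ‖spaceC d ξ‖ := by
  rw [IsSpacelike, minkowskiForm_self] at hξ
  have h : (ξ 0) ^ 2 < ‖spaceC d ξ‖ ^ 2 := by linarith
  exact abs_lt.2 (abs_lt_of_sq_lt_sq' h (norm_nonneg _))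

section Transport

variable [NeZero d] {S : SchwingerFamily (EuclideanSpace ℝ (Fin (d + 1)))}
  {𝔚 : (Fin n → Fin (d + 1) → ℂ) → ℂ} {T : 𝓢((Fin n → SpaceTime d), ℂ) →L[ℂ] ℂ}

/-- **A spatial reflection turning a space-like vector into the first spatial direction**: for
`ξ` space-like there is a linear isometry `R` of `ℝ^d` with `(1 ⊕ R) ξ = (ξ⁰, ‖ξ⃗‖, 0, …, 0)`, so
that `|((1 ⊕ R)ξ)⁰| < ((1 ⊕ R)ξ)¹` (Mathlib's `reflection_sub`). [folklore] -/
theorem exists_spatialIsometry_apply_first {ξ : SpaceTime d} (hξ : IsSpacelike ξ) :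
    ∃ R : EuclideanSpace ℝ (Fin d) ≃ₗᵢ[ℝ] EuclideanSpace ℝ (Fin d),
      |(spatialRotation R.toContinuousLinearEquiv ξ) 0| <
        (spatialRotation R.toContinuousLinearEquiv ξ)
          (Fin.succ ⟨0, Nat.pos_of_ne_zero (NeZero.ne d)⟩) := by
  set i₀ : Fin d := ⟨0, Nat.pos_of_ne_zero (NeZero.ne d)⟩ with hi₀
  set v : EuclideanSpace ℝ (Fin d) := spaceC d ξ with hv
  set w : EuclideanSpace ℝ (Fin d) := ‖v‖ • EuclideanSpace.single i₀ (1 : ℝ) with hw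
  have hvw : ‖v‖ = ‖w‖ := by
    rw [hw, norm_smul, PiLp.norm_single, norm_one, mul_one, norm_norm]
  refine ⟨Submodule.reflection (ℝ ∙ (v - w))ᗮ, ?_⟩
  have hR : Submodule.reflection (ℝ ∙ (v - w))ᗮ v = w := Submodule.reflection_sub hvw
  rw [spatialRotation_apply, ofTimeSpace_apply_zero, ofTimeSpace_apply_succ, timeC_apply]
  simp only [LinearIsometryEquiv.coe_toContinuousLinearEquiv]
  rw [← hv, hR, hw, PiLp.smul_apply, PiLp.single_apply, if_pos rfl, smul_eq_mul, mul_one]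
  exact abs_apply_zero_lt_norm_spaceC_of_isSpacelike hξ

/-- **Local commutativity near every space-like pair.** Under the hypotheses of
`apply_permTest_swap_eq_of_edgeGrowth` but for an arbitrary configuration `x₀` with
`x₀_{j+1} − x₀_j` space-like, there is a neighbourhood `O` of `x₀` such that
`T F = T (F ∘ (j j+1))` for every `F` compactly supported in `O`: transport the statement at the
spatially reflected configuration `(1 ⊕ R) x₀` back with the invariance of `T` under `1 ⊕ R`
(E1, `HasDistributionalBoundaryValue.lorentz_eq`), the diagonal action commuting with the
permutation of the points. [cite: OsterwalderSchraderCMP1973, §4.5] -/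
theorem exists_nhds_apply_permTest_swap_eq (hE1 : S.IsEuclideanCovariant) (hE3 : S.IsSymmetric)
    (h𝔚 : DifferentiableOn ℂ 𝔚 (forwardTube d n)) (hbv : HasDistributionalBoundaryValue 𝔚 T)
    (hS : ∀ F : 𝓢((Fin n → EuclideanSpace ℝ (Fin (d + 1))), ℂ), IsTimeOrdered F →
      S n F = ∫ x, 𝔚 (euclideanPoint x) * F x)
    (hgrowth : HasEdgeGrowth 𝔚) (hBHW : exists_extension_extendedForwardTube (d := d) (n := n))
    (j : Fin n) (hj : (j : ℕ) + 1 < n) {x₀ : Fin n → SpaceTime d}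
    (hx₀ : IsSpacelike (x₀ ⟨(j : ℕ) + 1, hj⟩ - x₀ j)) :
    ∃ O ∈ 𝓝 x₀, ∀ F : 𝓢((Fin n → SpaceTime d), ℂ),
      HasCompactSupport (F : (Fin n → SpaceTime d) → ℂ) →
      tsupport (F : (Fin n → SpaceTime d) → ℂ) ⊆ O →
        T F = T (permTest (Equiv.swap j ⟨(j : ℕ) + 1, hj⟩) F) := by
  set j' : Fin n := ⟨(j : ℕ) + 1, hj⟩ with hj'def
  set τ := Equiv.swap j j' with hτ
  obtain ⟨R, hR⟩ := exists_spatialIsometry_apply_first hx₀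
  set Λ : SpaceTime d ≃L[ℝ] SpaceTime d := spatialRotation R.toContinuousLinearEquiv with hΛdef
  have hΛ : Λ ∈ lorentzGroup d := spatialRotation_mem_lorentzGroup R
  have ho : IsOrthochronous Λ := isOrthochronous_spatialRotation _
  -- the reflected configuration
  set x₀' : Fin n → SpaceTime d := fun k => Λ (x₀ k) with hx₀'
  have hx₀'diff : x₀' j' - x₀' j = Λ (x₀ j' - x₀ j) := by simp [hx₀']
  have hx₀'' : |(x₀' ⟨(j : ℕ) + 1, hj⟩ - x₀' j) 0| <
      (x₀' ⟨(j : ℕ) + 1, hj⟩ - x₀' j) (Fin.succ ⟨0, Nat.pos_of_ne_zero (NeZero.ne d)⟩) := by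
    rw [show (⟨(j : ℕ) + 1, hj⟩ : Fin n) = j' from rfl, hx₀'diff]; exact hR
  obtain ⟨O', hO', hloc⟩ := apply_permTest_swap_eq_of_edgeGrowth hE1 hE3 h𝔚 hbv hS hgrowth hBHW
    j hj hx₀''
  -- the pulled-back neighbourhood
  set ψ : (Fin n → SpaceTime d) → (Fin n → SpaceTime d) := fun x k => Λ (x k) with hψ
  have hψc : Continuous ψ := continuous_pi fun k => Λ.continuous.comp (continuous_apply k)
  refine ⟨ψ ⁻¹' O', hψc.continuousAt.preimage_mem_nhds hO', ?_⟩
  intro F hFc hFO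
  -- transported test functions
  set e : (Fin n → SpaceTime d) ≃L[ℝ] (Fin n → SpaceTime d) := lorentzDiag n Λ.symm with he
  have he_apply : ∀ x, e x = fun k => Λ.symm (x k) := fun x => rfl
  set G : 𝓢((Fin n → SpaceTime d), ℂ) := SchwartzMap.compCLMOfContinuousLinearEquiv ℂ e F with hG
  set G₂ : 𝓢((Fin n → SpaceTime d), ℂ) :=
    SchwartzMap.compCLMOfContinuousLinearEquiv ℂ e (permTest τ F) with hG₂
  have hGapp : ∀ x, G x = F fun k => Λ.symm (x k) := fun x => rfl
  have hG₂app : ∀ x, G₂ x = permTest τ F fun k => Λ.symm (x k) := fun x => rfl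
  have hTG : T G = T F := hbv.lorentz_eq hE1 h𝔚 hS hΛ ho hGapp
  have hTG₂ : T G₂ = T (permTest τ F) := hbv.lorentz_eq hE1 h𝔚 hS hΛ ho hG₂app
  have hperm : permTest τ G = G₂ := by
    ext x
    rw [permTest_apply, hGapp, hG₂app, permTest_apply]
    rfl
  -- support of `G`
  have hGc : HasCompactSupport (G : (Fin n → SpaceTime d) → ℂ) := by
    have : (G : (Fin n → SpaceTime d) → ℂ) = (F : (Fin n → SpaceTime d) → ℂ) ∘ e.toHomeomorph := by
      funext x; rfl
    rw [this]
    exact hFc.comp_homeomorph e.toHomeomorph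
  have hGO : tsupport (G : (Fin n → SpaceTime d) → ℂ) ⊆ O' := by
    have : (G : (Fin n → SpaceTime d) → ℂ) = (F : (Fin n → SpaceTime d) → ℂ) ∘ e.toHomeomorph := by
      funext x; rfl
    rw [this, tsupport_comp_eq_preimage]
    intro x hx
    have h1 : ψ (e.toHomeomorph x) ∈ O' := hFO hx
    have h2 : ψ (e.toHomeomorph x) = x := by
      funext k
      exact Λ.apply_symm_apply (x k)
    rwa [h2] at h1
  rw [← hTG, hloc G hGc hGO, hperm, hTG₂]

end Transport

/-! ### From the local statement to the distributional and the product forms of locality -/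

/-- **A locally local distribution is local** (the "extension from product test functions" of
Streater–Wightman p. 97, here from small neighbourhoods): if every configuration with
`x_{j+1} − x_j` space-like has a neighbourhood `O` with `T F = T (F ∘ (j j+1))` for all `F`
compactly supported in `O`, then `T (F ∘ (j j+1)) = T F` for all `F` compactly supported in the open
set where `x_j − x_{j+1}` is space-like (smooth partition of unity subordinate to a finite cover of
the support). [cite: StreaterWightman1964, Thm 3-2 (d) eq. (3-34)] -/
theorem isLocalDistribution_of_locally {T : 𝓢((Fin n → SpaceTime d), ℂ) →L[ℂ] ℂ}
    (hloc : ∀ (j : Fin n) (hj : (j : ℕ) + 1 < n) (x₀ : Fin n → SpaceTime d),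
      IsSpacelike (x₀ ⟨(j : ℕ) + 1, hj⟩ - x₀ j) →
      ∃ O ∈ 𝓝 x₀, ∀ F : 𝓢((Fin n → SpaceTime d), ℂ),
        HasCompactSupport (F : (Fin n → SpaceTime d) → ℂ) →
        tsupport (F : (Fin n → SpaceTime d) → ℂ) ⊆ O →
          T F = T (permTest (Equiv.swap j ⟨(j : ℕ) + 1, hj⟩) F)) :
    IsLocalDistribution d n T := by
  classical
  intro a b hab F hFc hF
  have hb : (b : ℕ) = (a : ℕ) + 1 := hab.symm
  have hj : (a : ℕ) + 1 < n := hb ▸ b.isLt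
  have hbeq : b = ⟨(a : ℕ) + 1, hj⟩ := Fin.ext hb
  subst hbeq
  set K := tsupport (F : (Fin n → SpaceTime d) → ℂ) with hK
  have hKc : IsCompact K := hFc
  -- neighbourhoods from the local statement around the points of `K`
  have hnb : ∀ x : K, ∃ O : Set (Fin n → SpaceTime d), IsOpen O ∧ (x : Fin n → SpaceTime d) ∈ O ∧
      ∀ G : 𝓢((Fin n → SpaceTime d), ℂ), HasCompactSupport (G : (Fin n → SpaceTime d) → ℂ) →
        tsupport (G : (Fin n → SpaceTime d) → ℂ) ⊆ O →
          T G = T (permTest (Equiv.swap a ⟨(a : ℕ) + 1, hj⟩) G) := by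
    intro x
    have hsp : IsSpacelike ((x : Fin n → SpaceTime d) ⟨(a : ℕ) + 1, hj⟩ - (x : Fin n → SpaceTime d) a) := by
      have h := hF x.2
      simp only [Set.mem_setOf_eq] at h
      unfold IsSpacelike at h ⊢
      rw [← neg_sub, map_neg, map_neg, _root_.neg_apply, neg_neg]
      exact h
    obtain ⟨O, hO, hO'⟩ := hloc a hj x hsp
    obtain ⟨U, hUO, hUo, hxU⟩ := _root_.mem_nhds_iff.1 hO
    exact ⟨U, hUo, hxU, fun G hGc hGU => hO' G hGc (hGU.trans hUO)⟩
  choose O hOo hxO hOloc using hnb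
  have hKU : K ⊆ ⋃ x : K, O x := fun y hy => mem_iUnion.2 ⟨⟨y, hy⟩, hxO ⟨y, hy⟩⟩
  obtain ⟨t, ht⟩ := hKc.elim_finite_subcover O hOo hKU
  have hKU' : K ⊆ ⋃ x : t, O x := by
    intro y hy
    have h := ht hy
    simp only [mem_iUnion] at h ⊢
    obtain ⟨x, hx, hy'⟩ := h
    exact ⟨⟨x, hx⟩, hy'⟩
  -- a smooth partition of unity on `K` subordinate to the finite subcover
  obtain ⟨ρ, hρ⟩ := SmoothPartitionOfUnity.exists_isSubordinate 𝓘(ℝ, Fin n → SpaceTime d)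
    hKc.isClosed (fun x : t => O x) (fun x => hOo x) hKU'
  have hρs : ∀ i : t, ContDiff ℝ ∞ (fun y : Fin n → SpaceTime d => ((ρ i y : ℝ) : ℂ)) := fun i =>
    Complex.ofRealCLM.contDiff.comp (contMDiff_iff_contDiff.1 (ρ i).contMDiff)
  have hGs : ∀ i : t, ContDiff ℝ ∞ (fun y => ((ρ i y : ℝ) : ℂ) * F y) := fun i =>
    (hρs i).mul (F.smooth ⊤)
  have hGc : ∀ i : t, HasCompactSupport (fun y => ((ρ i y : ℝ) : ℂ) * F y) := fun i =>
    hFc.mul_left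
  let Fi : t → 𝓢((Fin n → SpaceTime d), ℂ) := fun i => (hGc i).toSchwartzMap (hGs i)
  have hFi_apply : ∀ i y, Fi i y = ((ρ i y : ℝ) : ℂ) * F y := fun i y => rfl
  have hsum : ∑ i, Fi i = F := by
    ext y
    simp only [sum_apply, hFi_apply, ← Finset.sum_mul]
    by_cases hy : y ∈ K
    · have h1 : ∑ i, (ρ i y : ℝ) = 1 := by
        have := ρ.sum_eq_one hy
        rwa [finsum_eq_sum_of_fintype] at this
      rw [← Complex.ofReal_sum, h1, Complex.ofReal_one, one_mul]
    · rw [image_eq_zero_of_notMem_tsupport hy, mul_zero]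
  have hFi_supp : ∀ i : t, tsupport (Fi i : (Fin n → SpaceTime d) → ℂ) ⊆ O i := by
    intro i
    refine subset_trans ?_ (hρ i)
    rw [← tsupport_ofReal_comp]
    exact tsupport_mul_subset_left
  -- the functional `T ∘ (a b) − T` kills every piece
  let Φ : 𝓢((Fin n → SpaceTime d), ℂ) →L[ℂ] ℂ := T.comp (permTest (Equiv.swap a ⟨(a : ℕ) + 1, hj⟩)) - T
  have hΦ : ∀ i : t, Φ (Fi i) = 0 := by
    intro i
    show T (permTest (Equiv.swap a ⟨(a : ℕ) + 1, hj⟩) (Fi i)) - T (Fi i) = 0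
    rw [sub_eq_zero]
    exact (hOloc i (Fi i) (hGc i) (hFi_supp i)).symm
  have h0 : Φ F = 0 := by
    rw [← hsum, map_sum]
    exact Finset.sum_eq_zero fun i _ => hΦ i
  have h0' : T (permTest (Equiv.swap a ⟨(a : ℕ) + 1, hj⟩) F) - T F = 0 := h0
  exact sub_eq_zero.1 h0'

/-- **From compactly supported to all test functions**: a local distribution satisfies
`T (F ∘ (j j+1)) = T F` for every Schwartz `F` whose support lies in the open set where
`x_j − x_{j+1}` is space-like (cut-off approximation `χ_R F → F` in `𝒮`, continuity of `T` and of
`F ↦ F ∘ (j j+1)`). [folklore] -/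
theorem IsLocalDistribution.apply_permTest_swap {T : 𝓢((Fin n → SpaceTime d), ℂ) →L[ℂ] ℂ}
    (hT : IsLocalDistribution d n T) (a b : Fin n) (hab : (a : ℕ) + 1 = b)
    (F : 𝓢((Fin n → SpaceTime d), ℂ))
    (hF : tsupport (F : (Fin n → SpaceTime d) → ℂ) ⊆ {x | IsSpacelike (x a - x b)}) :
    T (permTest (Equiv.swap a b) F) = T F := by
  obtain ⟨u, hu, hlim⟩ := exists_tsupport_subset_inter_closedBall_tendsto F
  have h1 : Tendsto (fun m => T (permTest (Equiv.swap a b) (u m))) atTop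
      (𝓝 (T (permTest (Equiv.swap a b) F))) :=
    ((T.comp (permTest (Equiv.swap a b))).continuous.tendsto F).comp hlim
  have h2 : Tendsto (fun m => T (u m)) atTop (𝓝 (T F)) := (T.continuous.tendsto F).comp hlim
  refine tendsto_nhds_unique h1 (h2.congr fun m => ?_)
  refine (hT a b hab (u m) ?_ ((hu m).trans (Set.inter_subset_left.trans hF))).symm
  exact IsCompact.of_isClosed_subset (isCompact_closedBall _ _) (isClosed_tsupport _)
    ((hu m).trans Set.inter_subset_right)

/-- **The product form of locality (Streater–Wightman (3-27), `IsLocalFamily`) from the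
distributional form**, for a family of distributions of one scalar field: a product
`f₁ ⊗ ⋯ ⊗ fₙ` with the supports of `f_j`, `f_{j+1}` space-like separated is supported where
`x_j − x_{j+1}` is space-like, and the witness of the swapped product is `F ∘ (j j+1)`.
[cite: StreaterWightman1964, §3-3 eq. (3-27)] -/
theorem isLocalFamily_of_isLocalDistribution {𝒲 : WightmanFamily d Unit}
    (h : ∀ n : ℕ, IsLocalDistribution d n (𝒲 n fun _ => ())) : IsLocalFamily 𝒲 := by
  intro n k f j hj F F' hF hF' hsep
  obtain rfl := unitLabels_eq k
  set j' : Fin n := ⟨(j : ℕ) + 1, hj⟩ with hj'def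
  -- the witness of the swapped product is `F ∘ (j j')`
  have hF'eq : F' = permTest (Equiv.swap j j') F := by
    ext x
    rw [permTest_apply, hF' x, hF (x ∘ Equiv.swap j j')]
    calc ∏ i, (f ∘ Equiv.swap j j') i (x i)
        = ∏ i, (fun m => f m (x (Equiv.swap j j' m))) (Equiv.swap j j' i) :=
          Finset.prod_congr rfl fun i _ => by simp [Equiv.swap_apply_self]
      _ = ∏ m, f m (x (Equiv.swap j j' m)) :=
          Equiv.prod_comp (Equiv.swap j j') (fun m => f m (x (Equiv.swap j j' m)))
      _ = ∏ i, f i ((x ∘ Equiv.swap j j') i) := rfl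
  -- the support of `F` lies where `x_j − x_{j'}` is space-like
  have hsupp : tsupport (F : (Fin n → SpaceTime d) → ℂ) ⊆ {x | IsSpacelike (x j - x j')} := by
    intro x hx
    have hmem := hF.tsupport_subset hx
    exact hsep (x j) (hmem j) (x j') (hmem j')
  have hk : (fun _ : Fin n => ()) ∘ Equiv.swap j j' = fun _ => () := rfl
  rw [hk, hF'eq]
  exact (IsLocalDistribution.apply_permTest_swap (h n) j j' rfl F hsupp).symm

/-! ### Assembly -/

/-- **Locality of an OS continuation family with edge growth**: for an OS family `S`
(E1, E3 used) and its continuation family `𝒲`, if every continuation `𝔚ₙ` has polynomial growth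
at the edge of the tube and the Bargmann–Hall–Wightman theorem holds in dimension `d + 1`, then
`𝒲` is local (property (d)). [cite: OsterwalderSchraderCMP1973, §4.5] -/
theorem IsOSContinuationFamily.isLocalFamily_of_edgeGrowth [NeZero d]
    {S : SchwingerFamily (EuclideanSpace ℝ (Fin (d + 1)))} {𝒲 : WightmanFamily d Unit}
    (hOS : S.IsOSFamily)
    (hcont : ∀ n : ℕ, ∃ 𝔚 : (Fin n → Fin (d + 1) → ℂ) → ℂ,
      DifferentiableOn ℂ 𝔚 (forwardTube d n) ∧
      HasDistributionalBoundaryValue 𝔚 (𝒲 n fun _ => ()) ∧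
      (∀ F : 𝓢((Fin n → EuclideanSpace ℝ (Fin (d + 1))), ℂ), IsTimeOrdered F →
        S n F = ∫ x : Fin n → EuclideanSpace ℝ (Fin (d + 1)), 𝔚 (euclideanPoint x) * F x) ∧
      HasEdgeGrowth 𝔚)
    (hBHW : ∀ m : ℕ, exists_extension_extendedForwardTube (d := d) (n := m)) :
    IsLocalFamily 𝒲 := by
  refine isLocalFamily_of_isLocalDistribution fun n => ?_
  obtain ⟨𝔚, h𝔚, hbv, hS, hgrowth⟩ := hcont n
  exact isLocalDistribution_of_locally fun j hj x₀ hx₀ =>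
    exists_nhds_apply_permTest_swap_eq hOS.covariant hOS.symmetric h𝔚 hbv hS hgrowth (hBHW n)
      j hj hx₀

/-- **`OS1973_local` from the three classical facts** — the continuation with half-space support
of its Fourier–Laplace representation (A₁₂⁺, `OS1975_exists_continuation_halfSpace`), the
Fourier–Laplace representation with edge growth (`fourierLaplace_coneSupport_edgeGrowth`, for the
index types `Fin n × Fin (d + 1)`), and the Bargmann–Hall–Wightman theorem
(`exists_extension_extendedForwardTube`). Proof: the continuation family is the one of (A₁₂⁺)
(uniqueness); its Fourier support lies in the spectral set (Lorentz invariance, proved); the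
Fourier–Laplace fact gives the edge growth of the OS continuations
(`hasEdgeGrowth_of_fourierSupportedIn`); then `IsOSContinuationFamily.isLocalFamily_of_edgeGrowth`.
[cite: OsterwalderSchraderCMP1973, §4.5] -/
theorem OS1973_local_of_facts (hA : OS1975_exists_continuation_halfSpace)
    (hFL : ∀ d n : ℕ, fourierLaplace_coneSupport_edgeGrowth (Fin n × Fin (d + 1)))
    (hBHW : ∀ d m : ℕ, exists_extension_extendedForwardTube (d := d) (n := m)) :
    OS1973_local := by
  intro d _ S hS hE0' 𝒲 h𝒲
  obtain ⟨𝒲', h𝒲', hhalf⟩ := hA d S hS hE0'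
  obtain rfl : 𝒲 = 𝒲' := h𝒲.unique h𝒲'
  have hspec : HasSpectralCondition 𝒲 :=
    𝒲.hasSpectralCondition_of_halfSpace
      (fun n k => h𝒲.isLorentzInvariantDistribution hS.covariant n k) hhalf
  refine IsOSContinuationFamily.isLocalFamily_of_edgeGrowth hS (fun n => ?_) (hBHW d)
  obtain ⟨𝔚, h𝔚, hbv, hSn⟩ := h𝒲 n
  exact ⟨𝔚, h𝔚, hbv, hSn,
    hasEdgeGrowth_of_fourierSupportedIn h𝔚 hbv (hspec n fun _ => ()) (hFL d n)⟩

/-- **`os_reconstruction` with locality proved**: from (A₁₂⁺), the Fourier–Laplace fact with edge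
growth, the Bargmann–Hall–Wightman theorem, and the two remaining Wightman properties
(e) positivity (OS I §4.3) and (f) the cluster property (OS I §4.4) of the OS boundary values.
Compared with `os_reconstruction_of_remaining'`, the OS-specific named fact `OS1973_local` has
been replaced by two classical generic facts. [cite: OsterwalderSchraderCMP1975, §IV.1 Theorem E'→R'] -/
theorem os_reconstruction_of_facts (hA : OS1975_exists_continuation_halfSpace)
    (hFL : ∀ d n : ℕ, fourierLaplace_coneSupport_edgeGrowth (Fin n × Fin (d + 1)))
    (hBHW : ∀ d m : ℕ, exists_extension_extendedForwardTube (d := d) (n := m))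
    (hR2 : OS1973_positiveDefinite) (hR4 : OS1973_cluster) : os_reconstruction :=
  os_reconstruction_of_remaining' hA (OS1973_local_of_facts hA hFL hBHW) hR2 hR4

end Literature.MathematicalPhysics.QuantumFieldTheory
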